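import Literature.NumberTheory.Automorphic.Liu2021.Def411WeilCarriersChiUnitary
import Literature.NumberTheory.Automorphic.RelNormOneTorusLevel
import Literature.NumberTheory.Automorphic.UnitaryGroupFinAdelicCenterLocal
import HarnessLib

/-!
# Class finiteness of the finite-adelic norm-one torus at every level: `E¹ · U \ U(1)(𝔸_{F,f})` is finite

Topic `NumberTheory/Automorphic`; namespace `Literature.NumberTheory.Automorphic.UnitaryGroup` (the home of ★ `finAdelicOne`,
`finAdelicCenter`).  One `def` with body (`finAdelicOneRat`, the subgroup generated by the rational norm-one elements) and
THEOREMS; no named fact, no `sorry`.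

* `finAdelicOneRat F E c` — the subgroup of `U(1)(𝔸_{F,f}) = finAdelicOne F E c` generated by the diagonal images `(x)` of the
  rational norm-one elements `x ∈ E¹` (the binder shape of ★ `IsAutomorphicOneChar`);
* **`finiteIndex_finAdelicOneRat_sup`** — for `[E : F] = 2`, `c ≠ 1` and every OPEN subgroup `U`, `E¹·U` has FINITE INDEX in
  `U(1)(𝔸_{F,f})`: the finite part `y ↦ y_f` maps `U(1)(𝔸_F) = relNormOneIdeles F E` ONTO the finite-adelic torus (every `u` is
  `(1,u)_f`, ★ `finiteIdele_mem_adelicOne`), sends the rational points `relNormOneRat` into `finAdelicOneRat`, and ★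
  `finite_relNormOneQuot_sup_of_isOpen` (`RelNormOneTorusLevel`: the class number of the anisotropic torus at an open level is
  finite, from the compactness of `E¹ \ U(1)(𝔸_F)`) descends along it;
* `finiteIndex_finAdelicOneRat_sup_comap_finAdelicCenter` — in particular for `U := (·1_N)⁻¹(K)`, `K` open in `U(J)(𝔸_{F,f})`
  (★ `continuous_finAdelicCenter`); CM specialisation `…_cm`.
This is the finiteness behind «only finitely many central characters of a given level occur in `H¹` of the Shimura tower»
([Liu2021] proof of Thm. 4.15, l. 2199–2212; [PlatonovRapinchuk1994] Thm. 5.1).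

## References
* [PlatonovRapinchuk1994] V. Platonov, A. Rapinchuk, *Algebraic Groups and Number Theory* (1994), Thm. 5.1 (finiteness of class numbers).
* [Liu2021] Y. Liu, Camb. J. Math. 9 (2021): Def. 4.11 (l. 2090), proof of Thm. 4.15 (l. 2199–2212).
* [Mok2014] C. P. Mok, Mem. AMS 235 (2015), §1 Notation p. 5.
-/

set_option autoImplicit false

noncomputable section

open NumberField IsDedekindDomain
open _root_.Topology

namespace Literature.NumberTheory.Automorphic.UnitaryGroup

variable (F E : Type) [Field F] [NumberField F] [Field E] [NumberField E] [Algebra F E] (c : E ≃ₐ[F] E)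

/-- **`E¹ ≤ U(1)(𝔸_{F,f})`**: the subgroup generated by the diagonal images `(x)_𝔸` of the rational norm-one elements `x ∈ E¹`
(the elements on which the automorphic characters of ★ `IsAutomorphicOneChar` are trivial). [cite: Liu2021, Def. 4.11 (l. 2090)] -/
def finAdelicOneRat : Subgroup (finAdelicOne F E c) :=
  Subgroup.closure
    {u | ∃ (x : Eˣ) (hx : Units.map (algebraMap E (FiniteAdeleRing (𝓞 E) E)).toMonoidHom x ∈ finAdelicOne F E c), u = ⟨_, hx⟩}

omit [NumberField F] in
/-- the generators lie in `finAdelicOneRat`. [cite: Liu2021, Def. 4.11 (l. 2090)] -/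
theorem mk_mem_finAdelicOneRat (x : Eˣ)
    (hx : Units.map (algebraMap E (FiniteAdeleRing (𝓞 E) E)).toMonoidHom x ∈ finAdelicOne F E c) :
    (⟨_, hx⟩ : finAdelicOne F E c) ∈ finAdelicOneRat F E c :=
  Subgroup.subset_closure ⟨x, hx, rfl⟩

omit [NumberField F] in
/-- a homomorphism out of `U(1)(𝔸_{F,f})` killing every rational norm-one `(x)` kills `finAdelicOneRat`. [cite: Liu2021, Def. 4.11 (l. 2090)] -/
theorem finAdelicOneRat_le_ker {M : Type*} [Group M] (f : finAdelicOne F E c →* M)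
    (hf : ∀ (x : Eˣ) (hx : Units.map (algebraMap E (FiniteAdeleRing (𝓞 E) E)).toMonoidHom x ∈ finAdelicOne F E c),
      f ⟨_, hx⟩ = 1) :
    finAdelicOneRat F E c ≤ f.ker := by
  rw [finAdelicOneRat, Subgroup.closure_le]
  rintro _ ⟨x, hx, rfl⟩
  exact hf x hx

/-- the finite part of the principal idèle `(x)` is the principal finite idèle `(x)` (Mathlib's `unitEmbedding` unfolded). [folklore] -/
private theorem finitePart_principalIdele_eq_unitsMap' (x : Eˣ) :
    finitePart E (GaloisRepresentations.principalIdele E x) =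
      Units.map (algebraMap E (FiniteAdeleRing (𝓞 E) E)).toMonoidHom x :=
  Units.ext rfl

/-- `finitePart` is continuous (second projection of `𝔸_E = E_∞ × 𝔸_E^∞` on units). [folklore] -/
private theorem continuous_finitePart' : Continuous (finitePart E) :=
  Continuous.units_map _ continuous_snd

/-- **`E¹ · U` has finite index in `U(1)(𝔸_{F,f})` for every open subgroup `U`** (`[E : F] = 2`, `c ≠ 1`): the finite part
`U(1)(𝔸_F) ↠ U(1)(𝔸_{F,f})` is onto, maps `relNormOneRat` into `finAdelicOneRat`, and the class number of the anisotropic torus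
`U(1)_{E/F}` at the open level `(·_f)⁻¹ U` is finite (★ `finite_relNormOneQuot_sup_of_isOpen`).
[cite: PlatonovRapinchuk1994, Thm. 5.1] -/
theorem finiteIndex_finAdelicOneRat_sup (h2 : Module.finrank F E = 2) (hc : c ≠ 1) (U : Subgroup (finAdelicOne F E c))
    (hU : IsOpen (U : Set (finAdelicOne F E c))) : (finAdelicOneRat F E c ⊔ U).FiniteIndex := by
  -- membership transfer `relNormOneIdeles F E = adelicOne F E c`
  have hmem : ∀ y : relNormOneIdeles F E, ((y : (AdeleRing (𝓞 E) E)ˣ)) ∈ adelicOne F E c := fun y =>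
    (mem_adelicOne_iff_mem_relNormOneIdeles F E c h2 hc _).2 y.2
  -- the finite part `φ : U(1)(𝔸_F) →* U(1)(𝔸_{F,f})`
  let φ : relNormOneIdeles F E →* finAdelicOne F E c :=
    ((finitePart E).comp (relNormOneIdeles F E).subtype).codRestrict (finAdelicOne F E c)
      fun y => finitePart_mem_finAdelicOne F E c (hmem y)
  have hφc : Continuous φ := ((continuous_finitePart' E).comp continuous_subtype_val).subtype_mk _
  -- `φ` is onto: `u = (1, u)_f`
  have hφs : Function.Surjective φ := fun u => by
    have hU' : finiteIdele E (u : (FiniteAdeleRing (𝓞 E) E)ˣ) ∈ relNormOneIdeles F E :=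
      (mem_adelicOne_iff_mem_relNormOneIdeles F E c h2 hc _).1 (finiteIdele_mem_adelicOne F E c u)
    exact ⟨⟨_, hU'⟩, Subtype.ext (finitePart_finiteIdele E _)⟩
  -- the quotient map `U(1)(𝔸_F) → U(1)(𝔸_{F,f}) / (E¹·U)` kills `relNormOneRat ⊔ φ⁻¹ U`
  set N : Subgroup (finAdelicOne F E c) := finAdelicOneRat F E c ⊔ U with hN
  let ψ : relNormOneIdeles F E →* finAdelicOne F E c ⧸ N := (QuotientGroup.mk' N).comp φ
  have hψ : relNormOneRat F E ⊔ U.comap φ ≤ ψ.ker := by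
    refine sup_le ?_ ?_
    · intro a ha
      rw [mem_relNormOneRat_iff] at ha
      obtain ⟨x, hx⟩ := ha
      have hx' : Units.map (algebraMap E (FiniteAdeleRing (𝓞 E) E)).toMonoidHom x ∈ finAdelicOne F E c := by
        rw [← finitePart_principalIdele_eq_unitsMap']
        exact finitePart_mem_finAdelicOne F E c (hx ▸ hmem a)
      have key : φ a = ⟨Units.map (algebraMap E (FiniteAdeleRing (𝓞 E) E)).toMonoidHom x, hx'⟩ := by
        apply Subtype.ext
        show finitePart E (a : (AdeleRing (𝓞 E) E)ˣ) = Units.map (algebraMap E (FiniteAdeleRing (𝓞 E) E)).toMonoidHom x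
        rw [← hx]
        exact finitePart_principalIdele_eq_unitsMap' E x
      rw [MonoidHom.mem_ker]
      show QuotientGroup.mk' N (φ a) = 1
      rw [key, QuotientGroup.mk'_apply, QuotientGroup.eq_one_iff]
      exact Subgroup.mem_sup_left (mk_mem_finAdelicOneRat F E c x hx')
    · intro a ha
      rw [MonoidHom.mem_ker]
      show QuotientGroup.mk' N (φ a) = 1
      rw [QuotientGroup.mk'_apply, QuotientGroup.eq_one_iff]
      exact Subgroup.mem_sup_right ha
  -- finiteness of `U(1)(𝔸_F) ⧸ (E¹ ⊔ φ⁻¹ U)` and descent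
  haveI : Finite (relNormOneIdeles F E ⧸ (relNormOneRat F E ⊔ U.comap φ)) :=
    finite_relNormOneQuot_sup_of_isOpen F E (U.comap φ) (hU.preimage hφc)
  haveI : Finite (finAdelicOne F E c ⧸ N) := by
    refine Finite.of_surjective (QuotientGroup.lift (relNormOneRat F E ⊔ U.comap φ) ψ hψ) ?_
    rintro ⟨u⟩
    obtain ⟨y, rfl⟩ := hφs u
    exact ⟨QuotientGroup.mk y, rfl⟩
  exact Subgroup.finiteIndex_of_finite_quotient

variable (N : ℕ) (J : Matrix (Fin N) (Fin N) E)

/-- **Level form**: for an open subgroup `K ≤ U(J)(𝔸_{F,f})`, `E¹ · (·1_N)⁻¹(K)` has finite index in `U(1)(𝔸_{F,f})` — finitely many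
classes of the centre at level `K` (★ `continuous_finAdelicCenter`). [cite: PlatonovRapinchuk1994, Thm. 5.1] -/
theorem finiteIndex_finAdelicOneRat_sup_comap_finAdelicCenter (h2 : Module.finrank F E = 2) (hc : c ≠ 1)
    (K : Subgroup (finAdelic F E c N J)) (hK : IsOpen (K : Set (finAdelic F E c N J))) :
    (finAdelicOneRat F E c ⊔ K.comap (finAdelicCenter F E c N J)).FiniteIndex :=
  finiteIndex_finAdelicOneRat_sup F E c h2 hc _ (hK.preimage (continuous_finAdelicCenter F E c N J))

end Literature.NumberTheory.Automorphic.UnitaryGroup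

/-! ## CM specialisation (`F = L⁺`, `E = L`, `c` = complex conjugation) -/

namespace Literature.NumberTheory.Automorphic.UnitaryGroup

variable (L : Type) [Field L] [NumberField L] [IsCMField L] (N : ℕ) (J : Matrix (Fin N) (Fin N) L)

/-- **CM case**: for every open `K ≤ U(J)(𝔸_{L⁺,f})`, the subgroup `L¹ · (·1_N)⁻¹(K)` of the finite-adelic norm-one torus of `L/L⁺`
has finite index. [cite: PlatonovRapinchuk1994, Thm. 5.1] -/
theorem finiteIndex_finAdelicOneRat_sup_comap_finAdelicCenter_cm
    (K : Subgroup (finAdelic (↥(maximalRealSubfield L)) L (IsCMField.complexConj L) N J))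
    (hK : IsOpen (K : Set (finAdelic (↥(maximalRealSubfield L)) L (IsCMField.complexConj L) N J))) :
    (finAdelicOneRat (↥(maximalRealSubfield L)) L (IsCMField.complexConj L) ⊔
      K.comap (finAdelicCenter (↥(maximalRealSubfield L)) L (IsCMField.complexConj L) N J)).FiniteIndex :=
  finiteIndex_finAdelicOneRat_sup_comap_finAdelicCenter _ L _ N J (Algebra.IsQuadraticExtension.finrank_eq_two _ L)
    (IsCMField.complexConj_ne_one (K := L)) K hK

end Literature.NumberTheory.Automorphic.UnitaryGroup

end
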